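import Literature.AnabelianGeometry.SemiGraphs.ProSigmaClosedSurfaceElastic
import Literature.AnabelianGeometry.SemiGraphs.ProSigmaPuncturedSurfaceElastic
import HarnessLib

/-!
# [AbsTopI] Prop 2.3 (i) at the FULL surface-group model: `Δ` slim and elastic for EVERY hyperbolic type `(g, r)`

S. Mochizuki, *Topics in Absolute Anabelian Geometry I: Generalities*, J. Math. Sci. Univ. Tokyo 19 (2012)
[AbsTopI], Proposition 2.3 (i), kurims manuscript p. 19 (lit key `paper:url-11ac98ba15fc`), as printed:

> **Proposition 2.3. (Slimness and Elasticity for Hyperbolic Orbicurves)** (i) Let `Δ` be a profinite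
> group of GFG-type that admits partial construction data `(k, X, Σ)` [consisting of the construction
> data field, construction data base-stack, and construction data prime set] such that `X` is a hyperbolic
> orbicurve [cf. §0], and `Σ` contains a prime invertible in `k`. Then `Δ` is slim and elastic.

abc-iut cell, layer L4, node `AbsTopI:Prop2.3(i)` (kernel id `N_AbsTopI_Prop2_3_i`; typed predicate
`FundamentalExtension.GeomSlimElastic` of abc-iut-L4-t4, `AbsTopISemiAbsolute.lean`; W6 tranche-2 row of seat
abc-iut-w6-d071).  PROOF-ONLY junction (no definition, no named fact, nothing restated): the tree proves the
conclusion AT THE SURFACE-GROUP MODEL in two landed halves with different hypothesis shapes —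

* closed class `r = 0`, `g ≥ 2`: abc-iut-L4-d1's
  `FundamentalExtension.geomSlimElastic_of_isProSigmaCompletion_closedSurfaceGroup`
  (`SemiGraphs/ProSigmaClosedSurfaceElastic.lean`, p424056);
* punctured class `r ≥ 1`, `2g − 2 + r > 0`: abc-iut-w5-d206's
  `SemiGraphOfAnabelioids.slim_and_elastic_of_isProSigmaCompletion_puncturedSurfaceGroup`
  (`SemiGraphs/ProSigmaPuncturedSurfaceElastic.lean`, p424779; Schreier rank route over abc-iut-L4-t15's
  affine criterion `isElastic_of_affine_rankFormula`),

and this file assembles them into ONE statement indexed, like print, by the hyperbolicity of the type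
`(g, r)` alone (`PuncturedSurfaceGroup.IsHyperbolicType g r := 2 < 2g + r`, [SemiAnbd] §0): for every
extension `E : 1 → Δ → Π → G → 1` of profinite groups whose `Δ` is presented as a pro-`Σ` completion
`ι : Γ_{g,r} → Δ` of a hyperbolic surface group, `Σ` a nonempty set of primes, the typed predicate
`E.GeomSlimElastic` HOLDS — with NO hypothesis on the base (`G` arbitrary: print's (i) has no MLF/NF clause).

HONEST SCOPE (what the model covers of print): `Δ ≅ Γ̂_{g,r}^{Σ}` is the geometric pro-`Σ` fundamental group
of a hyperbolic CURVE of type `(g, r)` over a field in which every prime of `Σ` is invertible (Riemann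
existence / [SGA1] XIII) — i.e. Def. 2.1 (i)'s construction data with trivial covering datum `Y = X`
("pro-`Σ`", not merely "almost pro-`Σ`"); print's statement is wider in three directions NOT typed here —
ALMOST pro-`Σ` GFG-type groups (nontrivial `Y → X`: `Δ_X` = maximal pro-`Σ` quotient of
`Ker(π₁^tame(X_k̄) → Gal(Y/X))`, an extension of the finite group `Gal(Y/X)`), ORBIcurves (stacky points:
orbifold surface groups with torsion), and base fields `k` of characteristic `p ∈ Σ` (print only asks that
`Σ` contain SOME prime invertible in `k`; then `Δ` is the tame/pro-`Σ` quotient, a proper quotient of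
`Γ̂_{g,r}^{Σ}`).  For an ABSTRACT `E` the predicate
`GeomSlimElastic` stays a hypothesis (its universal closure is refuted in the tree:
`not_forall_mlfBase_geomSlimElastic`, abc-iut-f-089, p429536).  Classical anabelian input
([MT] = Mochizuki–Tamagawa 2008, Prop 1.4 / Thm 1.5); OUR kernel check; nothing here bears on [IUTchIII]
Cor. 3.12; typed ≠ proved elsewhere.
-/

noncomputable section

namespace Literature.AnabelianGeometry.AbsoluteAnabelian.FundamentalExtension

open Literature.AnabelianGeometry.SemiGraphs.SemiGraphOfAnabelioids
open Literature.GroupTheory.CombinatorialGroupTheory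

universe u

variable (E : FundamentalExtension.{u}) {Sigma : Set ℕ} {g r : ℕ}

/-- A hyperbolic type `(g, 0)` has `g ≥ 2` (`2 < 2g + 0`). [cite: MochizukiAbsTopI2012, Prop 2.3 (i) p.19] -/
theorem two_le_genus_of_isHyperbolicType_zero (h : PuncturedSurfaceGroup.IsHyperbolicType g 0) : 2 ≤ g := by
  unfold PuncturedSurfaceGroup.IsHyperbolicType at h
  omega

/-- **[AbsTopI] Prop 2.3 (i) at the surface-group model, every hyperbolic type** — "`Δ` is slim and
elastic": for an extension `1 → Δ → Π → G → 1` of profinite groups (no hypothesis on `G`) whose `Δ` is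
presented as a pro-`Σ` completion `ι : Γ_{g,r} → Δ` of a surface group of HYPERBOLIC type
(`2g − 2 + r > 0`), `Σ` a nonempty set of primes, the typed predicate `E.GeomSlimElastic` holds.  Assembled
from the closed class (`r = 0`, abc-iut-L4-d1) and the punctured class (`r ≥ 1`, abc-iut-w5-d206) BY NAME.
[cite: MochizukiAbsTopI2012, Prop 2.3 (i) p.19] -/
theorem geomSlimElastic_of_isProSigmaCompletion_hyperbolic (hS : Sigma.Nonempty)
    (hSp : ∀ p ∈ Sigma, p.Prime) (hgr : PuncturedSurfaceGroup.IsHyperbolicType g r)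
    (ι : PuncturedSurfaceGroup g r →* E.geom) (hι : IsProSigmaCompletion Sigma ι) :
    E.GeomSlimElastic := by
  rcases Nat.eq_zero_or_pos r with hr | hr
  · subst hr
    exact E.geomSlimElastic_of_isProSigmaCompletion_closedSurfaceGroup hS hSp
      (two_le_genus_of_isHyperbolicType_zero hgr) ι hι
  · haveI : CompactSpace E.geom := isCompact_iff_compactSpace.mp E.isClosed_geom.isCompact
    obtain ⟨ℓ, hℓ⟩ := hS
    exact slim_and_elastic_of_isProSigmaCompletion_puncturedSurfaceGroup hr hgr hι
      ⟨ℓ, hℓ, hSp ℓ hℓ⟩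

/-- The slim half alone, every hyperbolic type ("`Δ` is slim"). [cite: MochizukiAbsTopI2012, Prop 2.3 (i) p.19] -/
theorem isSlimGroup_geom_of_isProSigmaCompletion_hyperbolic (hS : Sigma.Nonempty)
    (hSp : ∀ p ∈ Sigma, p.Prime) (hgr : PuncturedSurfaceGroup.IsHyperbolicType g r)
    (ι : PuncturedSurfaceGroup g r →* E.geom) (hι : IsProSigmaCompletion Sigma ι) :
    Literature.AlgebraicGeometry.Frobenioids.IsSlimGroup E.geom :=
  (E.geomSlimElastic_of_isProSigmaCompletion_hyperbolic hS hSp hgr ι hι).1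

/-- The elastic half alone, every hyperbolic type ("`Δ` is elastic"). [cite: MochizukiAbsTopI2012, Prop 2.3 (i) p.19] -/
theorem isElastic_geom_of_isProSigmaCompletion_hyperbolic (hS : Sigma.Nonempty)
    (hSp : ∀ p ∈ Sigma, p.Prime) (hgr : PuncturedSurfaceGroup.IsHyperbolicType g r)
    (ι : PuncturedSurfaceGroup g r →* E.geom) (hι : IsProSigmaCompletion Sigma ι) :
    IsElastic E.geom :=
  (E.geomSlimElastic_of_isProSigmaCompletion_hyperbolic hS hSp hgr ι hι).2

/-- The same statement with print's form of the prime-set hypothesis — "`Σ` contains a prime" (`∃ ℓ ∈ Σ`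
prime) — for a set `Σ` of primes. [cite: MochizukiAbsTopI2012, Prop 2.3 (i) p.19] -/
theorem geomSlimElastic_of_isProSigmaCompletion_hyperbolic' (hSp : ∀ p ∈ Sigma, p.Prime)
    (hS : ∃ ℓ ∈ Sigma, ℓ.Prime) (hgr : PuncturedSurfaceGroup.IsHyperbolicType g r)
    (ι : PuncturedSurfaceGroup g r →* E.geom) (hι : IsProSigmaCompletion Sigma ι) :
    E.GeomSlimElastic := by
  obtain ⟨ℓ, hℓ, -⟩ := hS
  exact E.geomSlimElastic_of_isProSigmaCompletion_hyperbolic ⟨ℓ, hℓ⟩ hSp hgr ι hι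

end Literature.AnabelianGeometry.AbsoluteAnabelian.FundamentalExtension

end
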